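import Summits.QuantumFields.YangMills.Theorems.CurvaturePoincareBoxUhlenbeck
import Summits.QuantumFields.YangMills.Theorems.CurvaturePoincareGaugeTransfer
import HarnessLib

/-!
# LINE 30 «CurvaturePoincare» — `stub_curvaturePinning` (NP) AS REGISTERED (stmt-QuantumFields-23532): the lattice Uhlenbeck ∕ nonlinear Poincaré pinning
# on boxes, with the absolute constant `C = 3`

Crux of record `PoincareLipschitz.MesoscopicConcentrationL` (stmt-QuantumFields-23532; LINE 30 skeleton `Cruxes/HistoryTailL/Lines/curvature_poincare.lean`
sha16 e95b7bfb5ac8bc91, ideator ym-r3-idea-2 g16); cell `ym3-torus` (YM ladder rung R3 = continuum `SU(2)` Yang–Mills on T³ — a RUNG, NOT the Clay problem);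
width seat `ym3-torus-px19` gen 9 (NP pen of record, ★★OWNER WORD 43).

THE STUB (registered text, token-identical below).  There is an absolute `C` (here `3`) such that for every box of side `n` at `x₀` (`1 ≤ n`, `2n ≤ sitesPerDir 0`)
and every gauge-invariant, box-local, `Λ`-link-Lipschitz `f`: `|f(U) − f(𝟙)| ≤ Λ·(C·n)·(Σ_{p ∈ boxPlaqs} dist₁(U(∂p))²)^{1/2}` for EVERY configuration `U`.

THE PROOF = the ideator's planNP cut, both halves landed:
* NP-core ✓ `CurvaturePoincareBoxUhlenbeck.boxUhlenbeck` (this seat; averaged axial gauges over the `n` roots of the bottom edge — `CurvaturePoincareAxialLadderSums`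
  (ladder sums along straight segments, the three bond directions in the gauge rooted at `lo + r·e₀`), `CurvaturePoincareBoxBonds` (box coordinates, rooted gauges on
  the torus, direction-`1` squared sums), `CurvaturePoincareBoxLineSums` (direction-`2` squared sums, line sums into `boxPlaqs`), `CurvaturePoincareBoxUhlenbeck`
  (the average: `Σ_r D_r ≤ 5n²(n−1)Σ_p ≤ n(3n)²Σ_p`)): `∃ g, Σ_{box bonds} dist₁((U^g)_b)² ≤ (3n)²·Σ_{boxPlaqs} dist₁(U(∂p))²`;
* NP-book ✓ `CurvaturePoincareGaugeTransfer.pinning_of_boxUhlenbeck` (px16 g11; gauge invariance + box-locality + the Lipschitz row at `(W, 𝟙)`).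
One term: `pinning_of_boxUhlenbeck boxUhlenbeck`.

HONEST SCOPE.  Proves the registered NP stub of LINE 30 and NOTHING of the residual `stub_moderateDeviationResidual` (MD, XL, organ-adjacent), of K1
`MesoscopicConcentrationL` (23532) itself, (Q) ∕ 23083, `HistoryTailL` (19936), EX (19200), 20520 or rung R3; R3 = continuum `SU(2)` YM on T³ — NOT d = 4, NOT infinite
volume, NOT a mass gap, NOT Clay; the Yang–Mills mass gap is NOT proved.  THEOREMS ONLY (0 `def`, 0 `sorry`); `--supports stmt-QuantumFields-23532` (STUB mode).

References: K. Uhlenbeck, CMP 83 (1982) 31–42 [Uhlenbeck1982] (the continuum statement this discretises, qualitatively); M. Creutz, «Quarks, gluons and lattices»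
(1983) ch. 9 [folklore]; T. Bałaban, CMP 98 (1985) pp. 24–25 [Balaban1985Averaging] (the tree-gauge bond identity).
-/

set_option autoImplicit false

open scoped BigOperators
open Literature.MathematicalPhysics.QuantumFieldTheory.Balaban1983to89
open Literature.MathematicalPhysics.QuantumFieldTheory.Balaban1983to89.T3ContinuumYM3Torus
open Literature.MathematicalPhysics.QuantumFieldTheory.Balaban1983to89.T4AxialGaugeSmallField (boxPlaqs)

namespace Summit.QuantumFields.YangMills.Theorems.CurvaturePoincareStubCurvaturePinning

open Classical in
/-- ★★★ **`stub_curvaturePinning` OF LINE 30 «CurvaturePoincare», AS REGISTERED on stmt-QuantumFields-23532** (skeleton `Cruxes/HistoryTailL/Lines/curvature_poincare.lean`,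
sha16 e95b7bfb5ac8bc91; token-identical statement): there is an absolute `C` with, for every box of side `n` at `x₀` (`1 ≤ n`, `2n ≤ sitesPerDir 0`), every
gauge-invariant, box-local, `Λ`-link-Lipschitz `f` (`0 ≤ Λ`) and every `U`,
`|f U − f 𝟙| ≤ Λ·(C·n)·√(Σ_{p ∈ boxPlaqs} dist₁(U(∂p))²)`.  Proof: `pinning_of_boxUhlenbeck boxUhlenbeck` (`C = 3`). [folklore] -/
theorem stub_curvaturePinning :
    ∃ C : ℝ, 0 < C ∧ ∀ (F : T3Family) (K n : ℕ) (x₀ : Site (F.P K) 0)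
      (f : GaugeField (F.P K) 0 (Matrix.specialUnitaryGroup (Fin 2) ℂ) → ℝ) (Λ : ℝ), 0 ≤ Λ → 1 ≤ n → 2 * n ≤ (F.P K).sitesPerDir 0 →
      GaugeField.GaugeInvariant f →
      (∀ U U' : GaugeField (F.P K) 0 (Matrix.specialUnitaryGroup (Fin 2) ℂ),
        (∀ b : PBond (F.P K) 0, (∀ k, (b.src k - x₀ k).val < n) → (∀ k, (b.tgt k - x₀ k).val < n) → U b = U' b) → f U = f U') →
      (∀ U U' : GaugeField (F.P K) 0 (Matrix.specialUnitaryGroup (Fin 2) ℂ),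
        |f U - f U'| ≤ Λ * Real.sqrt (∑ b : PBond (F.P K) 0, GaugeGroup.dist1 (U b * (U' b)⁻¹) ^ 2)) →
      ∀ U : GaugeField (F.P K) 0 (Matrix.specialUnitaryGroup (Fin 2) ℂ),
        |f U - f (fun _ => 1)| ≤ Λ * (C * (n : ℝ)) * Real.sqrt (∑ p ∈ Finset.univ.filter (fun p : Plaq (F.P K) 0 => p ∈ boxPlaqs (P := F.P K) (j := 0) (fun k => ((x₀ k).val : ℤ)) (fun k => ((x₀ k).val : ℤ) + ((n : ℤ) - 1))), GaugeGroup.dist1 (GaugeField.plaqHol U p) ^ 2) :=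
  CurvaturePoincareGaugeTransfer.pinning_of_boxUhlenbeck CurvaturePoincareBoxUhlenbeck.boxUhlenbeck

end Summit.QuantumFields.YangMills.Theorems.CurvaturePoincareStubCurvaturePinning
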